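import Mathlib
import Summits.ValiantsHypothesis.ValiantsHypothesis.Theorems.RigidityForcesSymmetryRankRigidMinimalReprLaplaceFiveSectorSplitDefs
import Summits.ValiantsHypothesis.ValiantsHypothesis.Theorems.RigidityForcesSymmetryRankRigidMinimalReprLaplaceFiveRelabel

/-!
# ValiantsHypothesis / RigidityForcesSymmetry — crux `LaplaceOptimalFive` (stmt-ValiantsHypothesis-24813):
# SEPARATED CAPTURE — the profile `2K₂` without side-symmetry

Crux idea #8 `separated-capture` (val-idea-19 g8; `Cruxes/LaplaceOptimalFive/Ideas/separated-capture.md` r4,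
`Cruxes/LaplaceOptimalFive/SeparatedCaptureSketch.lean` r4 @8c37d69649eb, memo `SeparatedCaptureLemmaH.md` @c6e1de38a657; referee
val-idea-crit-3 g5, PASS-WITH-PRICE — this file is the sharpened price P1).

MECHANISM.  On a `{3,4}`-SEPARATED pair profile (short sides among `01, 02, 12 | 34`) contract the exactness identity
`Σ_t u_t ⊗ w_t = P₅` against a leaf matrix `μ` on the slots `{3,4}` that annihilates every `{3,4}`-short factor: the leaf terms die and
the OBLIGATION TENSOR `P₅ ⌞ μ` (a symmetric 3-tensor on the slots `0,1,2`) is CAPTURED by the triangle configuration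
`U₀₁ ⊗ V₂ + U₀₂ ⊗ V₁ + U₁₂ ⊗ V₀` of short-factor spans (`obligation_captured`).  Contracting the free slot `2` against `𝟙` (the HUB
CONTRACTION) maps the ten obligations bijectively onto the symmetric zero-diagonal `5 × 5` matrices — LEMMA W: the pairs-vs-triples
inclusion matrix `W₂₃(5)`, alias the adjacency matrix `A` of the Petersen graph, is nonsingular, `A⁻¹ = (A + I − J/3)/2`
(`hub_injective`, ten explicit linear combinations) — and maps `U₀₁ ⊗ V₂` into `U₀₁`.  Hence, when there are no `02`/`12` terms,
`10 − n₃₄ ≤ dim W ≤ dim U₀₁ ≤ n₀₁` (`capture_one_direction`, `twoK2`): **every split decomposition of `P₅` on the cuts `{0,1}`, `{3,4}`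
(any multiplicities, off-shell factors, side-symmetric OR NOT) has at least ten terms, weight `≥ 120`**; `twoK2_relabel` moves it to any
two disjoint pairs.  To our knowledge the first K1-type kernel theorem WITHOUT the `SideSymmetric` hypothesis (the sum-rigidity census
✓ p662460 … ✓ p672506 is side-symmetric throughout).

HONEST FRAMING.  A SPECIAL CASE only: `LaplaceOptimalFive` (stmt-24813) stays OPEN · CONTESTED 72/120 (the general separated profile
`{01,02,12,34}` is EQUIVALENT to the open 3-slot capture inequality `CaptureIneq` of the sketch; hub profiles are untouched);
`RankRigidMinimalRepr`, the route, and `VP ≠ VNP` are NOT proved.  No `sorry`, no new axioms; Mathlib + tree only.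
-/

set_option linter.dupNamespace false
set_option autoImplicit false

namespace Summit.ValiantsHypothesis.ValiantsHypothesis.Theorems.RigidityForcesSymmetryRankRigidMinimalRepr

namespace LaplaceFiveSeparatedCapture

open Finset LaplaceFiveSectorSplit

/-! ### Objects -/

/-- The `5 × 5` permutation pattern `P₅ = [v injective]` (the right-hand side of the crux). -/
def perm5 (v : Fin 5 → Fin 5) : ℂ := if Function.Injective v then 1 else 0

/-- The word with letters `p q r` on the triangle slots `0 1 2` and `s t` on the leaf slots `3 4`. -/
def word (p q r s t : Fin 5) : Fin 5 → Fin 5 := ![p, q, r, s, t]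

/-- OBLIGATION TENSOR `P₅ ⌞ μ`: contraction of `P₅` against a leaf matrix `μ` on the slots `{3,4}`. -/
def contractZ (μ : Fin 5 → Fin 5 → ℂ) : Fin 5 → Fin 5 → Fin 5 → ℂ :=
  fun p q r => ∑ s : Fin 5, ∑ t : Fin 5, μ s t * perm5 (word p q r s t)

/-- TRIANGLE CONFIGURATION SPACE `L₃(U₀₁,U₀₂,U₁₂) = U₀₁ ⊗ V₂ + U₀₂ ⊗ V₁ + U₁₂ ⊗ V₀ ⊂ (ℂ⁵)^{⊗3}`. -/
def L3 (U01 U02 U12 : Submodule ℂ (Fin 5 → Fin 5 → ℂ)) : Submodule ℂ (Fin 5 → Fin 5 → Fin 5 → ℂ) :=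
  Submodule.span ℂ
    ({T | ∃ u ∈ U01, ∃ y : Fin 5 → ℂ, T = fun p q r => u p q * y r} ∪
     {T | ∃ u ∈ U02, ∃ y : Fin 5 → ℂ, T = fun p q r => u p r * y q} ∪
     {T | ∃ u ∈ U12, ∃ y : Fin 5 → ℂ, T = fun p q r => u q r * y p})

/-- Short factor of a term as a `5 × 5` matrix on the slot pair `(a, b)` (filler letter `0` elsewhere). -/
def short2 (f : (Fin 5 → Fin 5) → ℂ) (a b : Fin 5) : Fin 5 → Fin 5 → ℂ :=
  fun p q => f (Function.update (Function.update (fun _ => (0 : Fin 5)) a p) b q)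

/-- Span of the short factors of the terms on the cut with short side `{a, b}`. -/
def shortSpan {N : ℕ} (T : Finset (Fin N)) (S : Fin N → Finset (Fin 5)) (u : Fin N → (Fin 5 → Fin 5) → ℂ)
    (a b : Fin 5) : Submodule ℂ (Fin 5 → Fin 5 → ℂ) :=
  Submodule.span ℂ ((fun t => short2 (u t) a b) '' {t : Fin N | t ∈ T ∧ S t = ({a, b} : Finset (Fin 5))})

/-! ### Lemma W: the hub contraction is injective on symmetric zero-diagonal matrices -/

lemma ofFn_word (p q r s t : Fin 5) : List.ofFn (word p q r s t) = [p, q, r, s, t] := by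
  simp [word, List.ofFn_succ]

lemma perm5_word (p q r s t : Fin 5) :
    perm5 (word p q r s t) = if [p, q, r, s, t].Nodup then 1 else 0 := by
  unfold perm5
  by_cases h : Function.Injective (word p q r s t)
  · rw [if_pos h, if_pos]
    rw [← ofFn_word]
    exact List.nodup_ofFn.mpr h
  · rw [if_neg h, if_neg]
    rw [← ofFn_word]
    exact fun h' => h (List.nodup_ofFn.mp h')

set_option maxHeartbeats 1600000 in
/-- LEMMA W (hub contraction is injective on symmetric zero-diagonal matrices; the Petersen graph is nonsingular,
`A⁻¹ = (A + I − J/3)/2`). -/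
theorem hub_injective (μ : Fin 5 → Fin 5 → ℂ) (hs : ∀ s t, μ s t = μ t s) (hd : ∀ s, μ s s = 0)
    (hG : ∀ p q : Fin 5, (∑ r : Fin 5, contractZ μ p q r) = 0) : μ = 0 := by
  have e01 := hG 0 1
  have e02 := hG 0 2
  have e03 := hG 0 3
  have e04 := hG 0 4
  have e12 := hG 1 2
  have e13 := hG 1 3
  have e14 := hG 1 4
  have e23 := hG 2 3
  have e24 := hG 2 4
  have e34 := hG 3 4
  simp only [contractZ, Fin.sum_univ_five, perm5_word] at e01 e02 e03 e04 e12 e13 e14 e23 e24 e34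
  norm_num [List.nodup_cons, Fin.ext_iff] at e01 e02 e03 e04 e12 e13 e14 e23 e24 e34
  rw [hs 3 2, hs 4 2, hs 4 3] at e01
  rw [hs 3 1, hs 4 1, hs 4 3] at e02
  rw [hs 2 1, hs 4 1, hs 4 2] at e03
  rw [hs 2 1, hs 3 1, hs 3 2] at e04
  rw [hs 3 0, hs 4 0, hs 4 3] at e12
  rw [hs 2 0, hs 4 0, hs 4 2] at e13
  rw [hs 2 0, hs 3 0, hs 3 2] at e14
  rw [hs 1 0, hs 4 0, hs 4 1] at e23
  rw [hs 1 0, hs 3 0, hs 3 1] at e24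
  rw [hs 1 0, hs 2 0, hs 2 1] at e34
  have n01 : μ 0 1 = 0 := by linear_combination (1/6 : ℂ) * (e01 + e23 + e24 + e34) - (1/12 : ℂ) * (e02 + e03 + e04 + e12 + e13 + e14)
  have n02 : μ 0 2 = 0 := by linear_combination (1/6 : ℂ) * (e02 + e13 + e14 + e34) - (1/12 : ℂ) * (e01 + e03 + e04 + e12 + e23 + e24)
  have n03 : μ 0 3 = 0 := by linear_combination (1/6 : ℂ) * (e03 + e12 + e14 + e24) - (1/12 : ℂ) * (e01 + e02 + e04 + e13 + e23 + e34)
  have n04 : μ 0 4 = 0 := by linear_combination (1/6 : ℂ) * (e04 + e12 + e13 + e23) - (1/12 : ℂ) * (e01 + e02 + e03 + e14 + e24 + e34)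
  have n12 : μ 1 2 = 0 := by linear_combination (1/6 : ℂ) * (e12 + e03 + e04 + e34) - (1/12 : ℂ) * (e01 + e02 + e13 + e14 + e23 + e24)
  have n13 : μ 1 3 = 0 := by linear_combination (1/6 : ℂ) * (e13 + e02 + e04 + e24) - (1/12 : ℂ) * (e01 + e03 + e12 + e14 + e23 + e34)
  have n14 : μ 1 4 = 0 := by linear_combination (1/6 : ℂ) * (e14 + e02 + e03 + e23) - (1/12 : ℂ) * (e01 + e04 + e12 + e13 + e24 + e34)
  have n23 : μ 2 3 = 0 := by linear_combination (1/6 : ℂ) * (e23 + e01 + e04 + e14) - (1/12 : ℂ) * (e02 + e03 + e12 + e13 + e24 + e34)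
  have n24 : μ 2 4 = 0 := by linear_combination (1/6 : ℂ) * (e24 + e01 + e03 + e13) - (1/12 : ℂ) * (e02 + e04 + e12 + e14 + e23 + e34)
  have n34 : μ 3 4 = 0 := by linear_combination (1/6 : ℂ) * (e34 + e01 + e02 + e12) - (1/12 : ℂ) * (e03 + e04 + e13 + e14 + e23 + e24)
  have key : ∀ s t : Fin 5, s < t → μ s t = 0 := by
    intro s t hst
    fin_cases s <;> fin_cases t <;> simp (config := {decide := true}) at hst ⊢ <;> assumption
  funext s t
  rcases lt_trichotomy s t with hlt | rfl | hgt
  · exact key s t hlt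
  · exact hd s
  · rw [hs]; exact key t s hgt

/-! ### The hub contraction as a linear map; it sends `U₀₁ ⊗ V₂` into `U₀₁` -/

/-- `contractZ` as a linear map. -/
def cZ : (Fin 5 → Fin 5 → ℂ) →ₗ[ℂ] (Fin 5 → Fin 5 → Fin 5 → ℂ) where
  toFun := contractZ
  map_add' := by
    intro μ μ'
    funext p q r
    simp only [contractZ, Pi.add_apply, add_mul, Finset.sum_add_distrib]
  map_smul' := by
    intro c μ
    funext p q r
    simp only [contractZ, Pi.smul_apply, smul_eq_mul, RingHom.id_apply, Finset.mul_sum, mul_assoc]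

lemma cZ_apply (μ : Fin 5 → Fin 5 → ℂ) : cZ μ = contractZ μ := rfl

/-- HUB CONTRACTION: sum out the free triangle slot `2` (contraction against `𝟙`). -/
def hub : (Fin 5 → Fin 5 → Fin 5 → ℂ) →ₗ[ℂ] (Fin 5 → Fin 5 → ℂ) where
  toFun T := fun p q => ∑ r : Fin 5, T p q r
  map_add' := by
    intro T T'
    funext p q
    simp only [Pi.add_apply, Finset.sum_add_distrib]
  map_smul' := by
    intro c T
    funext p q
    simp only [Pi.smul_apply, smul_eq_mul, RingHom.id_apply, Finset.mul_sum]

lemma hub_apply (T : Fin 5 → Fin 5 → Fin 5 → ℂ) (p q : Fin 5) : hub T p q = ∑ r : Fin 5, T p q r := rfl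

/-- With no `02` / `12` directions, the hub contraction maps the triangle configuration space into `U₀₁`. -/
lemma L3_le_comap_hub (U01 : Submodule ℂ (Fin 5 → Fin 5 → ℂ)) : L3 U01 ⊥ ⊥ ≤ U01.comap hub := by
  unfold L3
  rw [Submodule.span_le]
  rintro T hT
  simp only [Set.mem_union, Set.mem_setOf_eq] at hT
  rw [SetLike.mem_coe, Submodule.mem_comap]
  rcases hT with (⟨u, hu, y, rfl⟩ | ⟨u, hu, y, rfl⟩) | ⟨u, hu, y, rfl⟩
  · have h : hub (fun p q r => u p q * y r) = (∑ r : Fin 5, y r) • u := by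
      funext p q
      simp only [hub_apply, Pi.smul_apply, smul_eq_mul, Finset.sum_mul]
      exact Finset.sum_congr rfl fun r _ => mul_comm _ _
    rw [h]
    exact U01.smul_mem _ hu
  · rw [(Submodule.mem_bot ℂ).mp hu]
    have h : hub (fun p q r => (0 : Fin 5 → Fin 5 → ℂ) p r * y q) = 0 := by
      funext p q
      simp [hub_apply]
    rw [h]
    exact U01.zero_mem
  · rw [(Submodule.mem_bot ℂ).mp hu]
    have h : hub (fun p q r => (0 : Fin 5 → Fin 5 → ℂ) q r * y p) = 0 := by
      funext p q
      simp [hub_apply]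
    rw [h]
    exact U01.zero_mem

/-- **ONE-DIRECTION CAPTURE INEQUALITY** (`CaptureIneq` of the sketch with `U₀₂ = U₁₂ = 0`): if every obligation `P₅ ⌞ μ`,
`μ` in a space `W` of symmetric zero-diagonal matrices, is captured by `U₀₁ ⊗ V₂`, then `dim W ≤ dim U₀₁`.  Proof: `hub ∘ contractZ`
maps `W` injectively (Lemma W) into `U₀₁`. [new] -/
theorem capture_one_direction (U01 U02 U12 W : Submodule ℂ (Fin 5 → Fin 5 → ℂ)) (h02 : U02 = ⊥) (h12 : U12 = ⊥)
    (hWs : ∀ μ ∈ W, ∀ s t : Fin 5, μ s t = μ t s) (hWd : ∀ μ ∈ W, ∀ s : Fin 5, μ s s = 0)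
    (hWc : ∀ μ ∈ W, contractZ μ ∈ L3 U01 U02 U12) :
    Module.finrank ℂ W ≤ Module.finrank ℂ U01 + Module.finrank ℂ U02 + Module.finrank ℂ U12 := by
  subst h02
  subst h12
  simp only [finrank_bot, add_zero]
  have hGmem : ∀ μ ∈ W, (hub ∘ₗ cZ) μ ∈ U01 := fun μ hμ =>
    Submodule.mem_comap.mp (L3_le_comap_hub U01 (hWc μ hμ))
  let f : W →ₗ[ℂ] U01 := LinearMap.codRestrict U01 ((hub ∘ₗ cZ).domRestrict W) (fun x => hGmem x.1 x.2)
  apply LinearMap.finrank_le_finrank_of_injective (f := f)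
  rw [injective_iff_map_eq_zero]
  intro x hx
  have h0 : (hub ∘ₗ cZ) x.1 = 0 := by
    have := congrArg Subtype.val hx
    simpa [f] using this
  have hμ : (x.1 : Fin 5 → Fin 5 → ℂ) = 0 :=
    hub_injective x.1 (hWs x.1 x.2) (hWd x.1 x.2) (fun p q => by
      have := congrFun (congrFun h0 p) q
      simpa [hub_apply, cZ_apply] using this)
  exact Subtype.ext hμ

set_option maxHeartbeats 1600000 in
theorem obligation_captured {N : ℕ} (T : Finset (Fin N)) (S : Fin N → Finset (Fin 5))
    (u w : Fin N → (Fin 5 → Fin 5) → ℂ) (hdec : IsSplitDecomposition T S u w)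
    (hsep : ∀ t ∈ T, S t = ({0, 1} : Finset (Fin 5)) ∨ S t = ({0, 2} : Finset (Fin 5)) ∨
      S t = ({1, 2} : Finset (Fin 5)) ∨ S t = ({3, 4} : Finset (Fin 5)))
    (μ : Fin 5 → Fin 5 → ℂ)
    (hμ : ∀ t ∈ T, S t = ({3, 4} : Finset (Fin 5)) → (∑ s : Fin 5, ∑ s' : Fin 5, μ s s' * short2 (u t) 3 4 s s') = 0) :
    contractZ μ ∈ L3 (shortSpan T S u 0 1) (shortSpan T S u 0 2) (shortSpan T S u 1 2) := by
  classical
  have hex : ∀ v : Fin 5 → Fin 5, (∑ t ∈ T, u t v * w t v) = perm5 v := hdec.2.2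
  -- short factors through `short2` (cylindricity of `u`)
  have hu01 : ∀ t, S t = ({0, 1} : Finset (Fin 5)) → ∀ p q r s t' : Fin 5,
      u t (word p q r s t') = short2 (u t) 0 1 p q := by
    intro t hS p q r s t'
    apply hdec.1 t
    intro i hi
    rw [hS] at hi
    simp only [Finset.mem_insert, Finset.mem_singleton] at hi
    rcases hi with rfl | rfl <;> simp [word]
  have hu02 : ∀ t, S t = ({0, 2} : Finset (Fin 5)) → ∀ p q r s t' : Fin 5,
      u t (word p q r s t') = short2 (u t) 0 2 p r := by
    intro t hS p q r s t'
    apply hdec.1 t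
    intro i hi
    rw [hS] at hi
    simp only [Finset.mem_insert, Finset.mem_singleton] at hi
    rcases hi with rfl | rfl <;> simp [word]
  have hu12 : ∀ t, S t = ({1, 2} : Finset (Fin 5)) → ∀ p q r s t' : Fin 5,
      u t (word p q r s t') = short2 (u t) 1 2 q r := by
    intro t hS p q r s t'
    apply hdec.1 t
    intro i hi
    rw [hS] at hi
    simp only [Finset.mem_insert, Finset.mem_singleton] at hi
    rcases hi with rfl | rfl <;> simp [word]
  have hu34 : ∀ t, S t = ({3, 4} : Finset (Fin 5)) → ∀ p q r s t' : Fin 5,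
      u t (word p q r s t') = short2 (u t) 3 4 s t' := by
    intro t hS p q r s t'
    apply hdec.1 t
    intro i hi
    rw [hS] at hi
    simp only [Finset.mem_insert, Finset.mem_singleton] at hi
    rcases hi with rfl | rfl <;> simp [word]
  -- long factors forget the short slots (cylindricity of `w`)
  have hw01 : ∀ t, S t = ({0, 1} : Finset (Fin 5)) → ∀ p q r s t' : Fin 5,
      w t (word p q r s t') = w t (word 0 0 r s t') := by
    intro t hS p q r s t'
    apply hdec.2.1 t
    intro i hi
    rw [hS] at hi
    fin_cases i <;> simp [word] at hi ⊢
  have hw02 : ∀ t, S t = ({0, 2} : Finset (Fin 5)) → ∀ p q r s t' : Fin 5,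
      w t (word p q r s t') = w t (word 0 q 0 s t') := by
    intro t hS p q r s t'
    apply hdec.2.1 t
    intro i hi
    rw [hS] at hi
    fin_cases i <;> simp [word] at hi ⊢
  have hw12 : ∀ t, S t = ({1, 2} : Finset (Fin 5)) → ∀ p q r s t' : Fin 5,
      w t (word p q r s t') = w t (word p 0 0 s t') := by
    intro t hS p q r s t'
    apply hdec.2.1 t
    intro i hi
    rw [hS] at hi
    fin_cases i <;> simp [word] at hi ⊢
  have hw34 : ∀ t, S t = ({3, 4} : Finset (Fin 5)) → ∀ p q r s t' : Fin 5,
      w t (word p q r s t') = w t (word p q r 0 0) := by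
    intro t hS p q r s t'
    apply hdec.2.1 t
    intro i hi
    rw [hS] at hi
    fin_cases i <;> simp [word] at hi ⊢
  -- the obligation tensor is the sum of the per-term contractions
  have key : contractZ μ = ∑ t ∈ T,
      (fun p q r => ∑ s : Fin 5, ∑ t' : Fin 5, μ s t' * (u t (word p q r s t') * w t (word p q r s t'))) := by
    funext p q r
    simp only [Finset.sum_apply, contractZ, ← hex, Finset.mul_sum]
    symm
    rw [Finset.sum_comm]
    refine Finset.sum_congr rfl (fun s _ => ?_)
    rw [Finset.sum_comm]
  rw [key]
  refine Submodule.sum_mem _ (fun t ht => ?_)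
  rcases hsep t ht with h01 | h02 | h12 | h34
  · -- cut 01 | 234 : contributes `short2 (u t) 0 1 ⊗ (w t ⌞ μ)` on slots (0,1) × 2
    have hmem : short2 (u t) 0 1 ∈ shortSpan T S u 0 1 :=
      Submodule.subset_span ⟨t, ⟨ht, h01⟩, rfl⟩
    have hF : (fun p q r => ∑ s : Fin 5, ∑ t' : Fin 5, μ s t' * (u t (word p q r s t') * w t (word p q r s t')))
        = fun p q r => short2 (u t) 0 1 p q * (∑ s : Fin 5, ∑ t' : Fin 5, μ s t' * w t (word 0 0 r s t')) := by
      funext p q r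
      rw [Finset.mul_sum]
      refine Finset.sum_congr rfl (fun s _ => ?_)
      rw [Finset.mul_sum]
      refine Finset.sum_congr rfl (fun t' _ => ?_)
      rw [hu01 t h01 p q r s t', hw01 t h01 p q r s t']
      ring
    rw [hF]
    apply Submodule.subset_span
    simp only [Set.mem_union, Set.mem_setOf_eq]
    exact Or.inl (Or.inl ⟨short2 (u t) 0 1, hmem, _, rfl⟩)
  · -- cut 02 | 134
    have hmem : short2 (u t) 0 2 ∈ shortSpan T S u 0 2 :=
      Submodule.subset_span ⟨t, ⟨ht, h02⟩, rfl⟩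
    have hF : (fun p q r => ∑ s : Fin 5, ∑ t' : Fin 5, μ s t' * (u t (word p q r s t') * w t (word p q r s t')))
        = fun p q r => short2 (u t) 0 2 p r * (∑ s : Fin 5, ∑ t' : Fin 5, μ s t' * w t (word 0 q 0 s t')) := by
      funext p q r
      rw [Finset.mul_sum]
      refine Finset.sum_congr rfl (fun s _ => ?_)
      rw [Finset.mul_sum]
      refine Finset.sum_congr rfl (fun t' _ => ?_)
      rw [hu02 t h02 p q r s t', hw02 t h02 p q r s t']
      ring
    rw [hF]
    apply Submodule.subset_span
    simp only [Set.mem_union, Set.mem_setOf_eq]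
    exact Or.inl (Or.inr ⟨short2 (u t) 0 2, hmem, _, rfl⟩)
  · -- cut 12 | 034
    have hmem : short2 (u t) 1 2 ∈ shortSpan T S u 1 2 :=
      Submodule.subset_span ⟨t, ⟨ht, h12⟩, rfl⟩
    have hF : (fun p q r => ∑ s : Fin 5, ∑ t' : Fin 5, μ s t' * (u t (word p q r s t') * w t (word p q r s t')))
        = fun p q r => short2 (u t) 1 2 q r * (∑ s : Fin 5, ∑ t' : Fin 5, μ s t' * w t (word p 0 0 s t')) := by
      funext p q r
      rw [Finset.mul_sum]
      refine Finset.sum_congr rfl (fun s _ => ?_)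
      rw [Finset.mul_sum]
      refine Finset.sum_congr rfl (fun t' _ => ?_)
      rw [hu12 t h12 p q r s t', hw12 t h12 p q r s t']
      ring
    rw [hF]
    apply Submodule.subset_span
    simp only [Set.mem_union, Set.mem_setOf_eq]
    exact Or.inr ⟨short2 (u t) 1 2, hmem, _, rfl⟩
  · -- leaf cut 34 | 012 : killed by `hμ`
    have hF : (fun p q r => ∑ s : Fin 5, ∑ t' : Fin 5, μ s t' * (u t (word p q r s t') * w t (word p q r s t')))
        = 0 := by
      funext p q r
      simp only [Pi.zero_apply]
      have : ∀ s t' : Fin 5, μ s t' * (u t (word p q r s t') * w t (word p q r s t'))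
          = (μ s t' * short2 (u t) 3 4 s t') * w t (word p q r 0 0) := by
        intro s t'
        rw [hu34 t h34 p q r s t', hw34 t h34 p q r s t']
        ring
      simp only [this, ← Finset.sum_mul, hμ t ht h34, zero_mul]
    rw [hF]
    exact Submodule.zero_mem _

set_option maxHeartbeats 1600000 in
/-- **`LaplaceOptimalFive` on the profile `2K₂ = {01, 34}` WITHOUT side-symmetry** (any multiplicities, off-shell factors allowed,
both young-shadow sectors): every split decomposition of `P₅` whose short sides are `{0,1}` or `{3,4}` has Laplace weight `≥ 120`, i.e.
at least ten terms.  Proof: the symmetric zero-diagonal leaf matrices annihilating the `{3,4}`-short factors form a space `W` with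
`dim W ≥ 10 − n₃₄` (rank–nullity on the `ℂ¹⁰` chart), every obligation `P₅ ⌞ μ, μ ∈ W` is captured by `U₀₁ ⊗ V₂`
(`obligation_captured`), and the one-direction capture inequality (`capture_one_direction`: hub contraction + Lemma W) gives
`10 − n₃₄ ≤ dim W ≤ m₀₁ ≤ n₀₁`. [new] -/
theorem twoK2 {N : ℕ} (T : Finset (Fin N)) (S : Fin N → Finset (Fin 5)) (u w : Fin N → (Fin 5 → Fin 5) → ℂ)
    (hdec : IsSplitDecomposition T S u w)
    (hC : ∀ t ∈ T, S t = ({0, 1} : Finset (Fin 5)) ∨ S t = ({3, 4} : Finset (Fin 5))) :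
    Nat.factorial 5 ≤ laplaceWeight T S := by
  classical
  have hsep : ∀ t ∈ T, S t = ({0, 1} : Finset (Fin 5)) ∨ S t = ({0, 2} : Finset (Fin 5)) ∨
      S t = ({1, 2} : Finset (Fin 5)) ∨ S t = ({3, 4} : Finset (Fin 5)) :=
    fun t ht => (hC t ht).elim Or.inl (fun h => Or.inr (Or.inr (Or.inr h)))
  -- no terms on the cuts 02, 12: those short spans vanish
  have hbot : ∀ a b : Fin 5, ({a, b} : Finset (Fin 5)) ≠ {0, 1} → ({a, b} : Finset (Fin 5)) ≠ {3, 4} →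
      shortSpan T S u a b = ⊥ := by
    intro a b h1 h2
    unfold shortSpan
    rw [Submodule.span_eq_bot]
    rintro x ⟨t, ⟨ht, hSt⟩, rfl⟩
    exfalso
    rcases hC t ht with h | h
    · exact h1 (hSt ▸ h)
    · exact h2 (hSt ▸ h)
  have h02bot : shortSpan T S u 0 2 = ⊥ := hbot 0 2 (by decide) (by decide)
  have h12bot : shortSpan T S u 1 2 = ⊥ := hbot 1 2 (by decide) (by decide)
  /- (1) the profile is made of pair cuts: weight = 12·|T| and the four cut classes are disjoint in T -/
  have hweight : laplaceWeight T S = 12 * T.card := by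
    unfold laplaceWeight
    rw [Finset.sum_congr rfl (g := fun _ => 12) ?_]
    · simp [mul_comm]
    · intro t ht
      rcases hsep t ht with h | h | h | h <;> rw [h] <;> decide
  have hcount :
      (T.filter (fun t => S t = ({0, 1} : Finset (Fin 5)))).card
        + (T.filter (fun t => S t = ({0, 2} : Finset (Fin 5)))).card
        + (T.filter (fun t => S t = ({1, 2} : Finset (Fin 5)))).card
        + (T.filter (fun t => S t = ({3, 4} : Finset (Fin 5)))).card ≤ T.card := by
    rw [Finset.card_filter, Finset.card_filter, Finset.card_filter, Finset.card_filter,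
      ← Finset.sum_add_distrib, ← Finset.sum_add_distrib, ← Finset.sum_add_distrib, Finset.card_eq_sum_ones T]
    apply Finset.sum_le_sum
    intro t ht
    rcases hsep t ht with h | h | h | h <;> rw [h] <;> decide
  /- (2) spans are at most as big as the number of terms on the cut -/
  have hm : ∀ a b : Fin 5, Module.finrank ℂ (shortSpan T S u a b)
      ≤ (T.filter (fun t => S t = ({a, b} : Finset (Fin 5)))).card := by
    intro a b
    have hset : ((fun t => short2 (u t) a b) '' {t : Fin N | t ∈ T ∧ S t = ({a, b} : Finset (Fin 5))})
        = (((T.filter (fun t => S t = ({a, b} : Finset (Fin 5)))).image (fun t => short2 (u t) a b) :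
            Finset (Fin 5 → Fin 5 → ℂ)) : Set (Fin 5 → Fin 5 → ℂ)) := by
      ext x
      simp
    unfold shortSpan
    rw [hset]
    exact (finrank_span_finset_le_card _).trans Finset.card_image_le
  /- (3) coordinates for the symmetric zero-diagonal leaf matrices: an injective linear chart from ℂ^{10} -/
  let P := {x : Fin 5 × Fin 5 // x.1 < x.2}
  have hP : Fintype.card P = 10 := by decide
  let LsymFun : (P → ℂ) → (Fin 5 → Fin 5 → ℂ) := fun c s t =>
    if h : s < t then c ⟨(s, t), h⟩ else if h' : t < s then c ⟨(t, s), h'⟩ else 0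
  let Lsym : (P → ℂ) →ₗ[ℂ] (Fin 5 → Fin 5 → ℂ) :=
    { toFun := LsymFun
      map_add' := by
        intro c c'
        funext s t
        simp only [LsymFun, Pi.add_apply]
        split_ifs <;> simp
      map_smul' := by
        intro r c
        funext s t
        simp only [LsymFun, Pi.smul_apply, smul_eq_mul, RingHom.id_apply]
        split_ifs <;> simp }
  have hLsym_apply : ∀ c s t, Lsym c s t = LsymFun c s t := fun _ _ _ => rfl
  have hinj : Function.Injective Lsym := by
    intro c c' h
    funext π
    have := congr_fun (congr_fun h π.1.1) π.1.2
    simpa [hLsym_apply, LsymFun, π.2] using this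
  have hsym : ∀ c (s t : Fin 5), Lsym c s t = Lsym c t s := by
    intro c s t
    simp only [hLsym_apply, LsymFun]
    rcases lt_trichotomy s t with h | rfl | h
    · simp [h, not_lt.mpr h.le]
    · simp
    · simp [h, not_lt.mpr h.le]
  have hdiag : ∀ c (s : Fin 5), Lsym c s s = 0 := by
    intro c s
    simp [hLsym_apply, LsymFun]
  /- (4) the leaf evaluation map and its kernel (rank–nullity: dim ker ≥ 10 − n₃₄) -/
  let ev : (Fin 5 → Fin 5 → ℂ) →ₗ[ℂ] ((T.filter (fun t => S t = ({3, 4} : Finset (Fin 5)))) → ℂ) :=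
    { toFun := fun M t => ∑ s : Fin 5, ∑ s' : Fin 5, M s s' * short2 (u t.1) 3 4 s s'
      map_add' := by
        intro M M'
        funext t
        simp only [Pi.add_apply, add_mul, Finset.sum_add_distrib]
      map_smul' := by
        intro r M
        funext t
        simp only [Pi.smul_apply, smul_eq_mul, RingHom.id_apply, Finset.mul_sum, mul_assoc] }
  have hev_apply : ∀ M t, ev M t = ∑ s : Fin 5, ∑ s' : Fin 5, M s s' * short2 (u t.1) 3 4 s s' :=
    fun _ _ => rfl
  let ev' : (P → ℂ) →ₗ[ℂ] ((T.filter (fun t => S t = ({3, 4} : Finset (Fin 5)))) → ℂ) := ev ∘ₗ Lsym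
  have hrn := LinearMap.finrank_range_add_finrank_ker ev'
  rw [Module.finrank_fintype_fun_eq_card, hP] at hrn
  have hrange : Module.finrank ℂ (LinearMap.range ev')
      ≤ (T.filter (fun t => S t = ({3, 4} : Finset (Fin 5)))).card := by
    have := Submodule.finrank_le (LinearMap.range ev')
    rwa [Module.finrank_fintype_fun_eq_card, Fintype.card_coe] at this
  /- (5) the captured space W := Lsym (ker ev') and the capture inequality -/
  have hWK : Module.finrank ℂ ((LinearMap.ker ev').map Lsym) = Module.finrank ℂ (LinearMap.ker ev') :=
    (LinearEquiv.finrank_eq (Submodule.equivMapOfInjective Lsym hinj (LinearMap.ker ev'))).symm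
  have hcapW : Module.finrank ℂ ((LinearMap.ker ev').map Lsym)
      ≤ Module.finrank ℂ (shortSpan T S u 0 1) + Module.finrank ℂ (shortSpan T S u 0 2)
        + Module.finrank ℂ (shortSpan T S u 1 2) := by
    apply capture_one_direction _ _ _ _ h02bot h12bot
    · intro μ hμ s t
      obtain ⟨c, -, rfl⟩ := Submodule.mem_map.1 hμ
      exact hsym c s t
    · intro μ hμ s
      obtain ⟨c, -, rfl⟩ := Submodule.mem_map.1 hμ
      exact hdiag c s
    · intro μ hμ
      obtain ⟨c, hcK, rfl⟩ := Submodule.mem_map.1 hμ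
      apply obligation_captured T S u w hdec hsep
      intro t ht h34
      have h0 := congr_fun (LinearMap.mem_ker.1 hcK) ⟨t, Finset.mem_filter.2 ⟨ht, h34⟩⟩
      rw [Pi.zero_apply] at h0
      simpa [ev', hev_apply] using h0
  /- (6) count -/
  have h01 := hm 0 1
  have h02 := hm 0 2
  have h12 := hm 1 2
  have h5 : Nat.factorial 5 = 120 := by decide
  rw [h5, hweight]
  omega

/-- `twoK2` on any placement: short sides `{π 0, π 1}` or `{π 3, π 4}` for a slot permutation `π` (two disjoint pairs). [new] -/
theorem twoK2_relabel {N : ℕ} (T : Finset (Fin N)) (S : Fin N → Finset (Fin 5)) (u w : Fin N → (Fin 5 → Fin 5) → ℂ)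
    (hdec : IsSplitDecomposition T S u w) (π : Equiv.Perm (Fin 5))
    (hC : ∀ t ∈ T, S t = ({π 0, π 1} : Finset (Fin 5)) ∨ S t = ({π 3, π 4} : Finset (Fin 5))) :
    Nat.factorial 5 ≤ laplaceWeight T S := by
  rw [← LaplaceFiveRelabel.laplaceWeight_relabel T S π.symm]
  refine twoK2 T _ _ _ (LaplaceFiveRelabel.isSplitDecomposition_relabel T S u w π.symm hdec) ?_
  intro t ht
  rcases hC t ht with h | h
  · left
    show (S t).image ⇑π.symm = _
    rw [h, LaplaceFiveRelabel.image_pair]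
    simp
  · right
    show (S t).image ⇑π.symm = _
    rw [h, LaplaceFiveRelabel.image_pair]
    simp

end LaplaceFiveSeparatedCapture

end Summit.ValiantsHypothesis.ValiantsHypothesis.Theorems.RigidityForcesSymmetryRankRigidMinimalRepr
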